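import Summits.QuantumFields.BalabanUV.T4Continuum.Support.NE7SliceLetterHodgeReduction
import Summits.QuantumFields.BalabanUV.T4Continuum.Support.NE3FrameFreeDecompositionW
import HarnessLib

/-!
# NE7SliceLetterFrameFreeReduction — (c₂)'s EXISTENCE HALF IS ALREADY IN THE TREE: row NE3's curved frame-free block-Landau slice `T_♮(W) = frameFreeBlockLandauW L N (j+1) W`
# receives every W-tangent skew periodic `X` after subtraction of the gauge direction of a CORNER-VANISHING generator (`NE3FrameFreeDecompositionW.exists_cornerGauge_mem_
# frameFreeBlockLandauW`, the owner swarm's (E_W)); so the repaired slice-solver letter (L2)ʰ on the WHOLE tangent slice reduces (F137) to TWO SUP-NORM letters about TREE OBJECTS: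
# (c₁)^∞ (L2)ʰ on `T_♮(W)` with constants `(K_G, K_X)`, and (c₂)^∞ the sup bound `‖gaugeDir W ξ‖_∞ ≤ C_H·‖X‖_∞` of that decomposition — plus the tension letter; then (L2)ʰ holds
# on all tangent fields with `K_X′ = (1 + C_H)K_X + 2d(M−1)C_H(x + K_G·τ_W)` (file 69 of the curved (APE))

Cell `pub-balaban`, rung (B)+1 sub-cell t4, lineage `b2b-balaban-t4-ne7-p1` (CRUX PROVER NE7 #1 = OWNER of row NE7), generation 80; memo
`t4/b2b-balaban-t4-ne7-p1-g80/SLICE-LETTER-OBSTRUCTION.md` §8.  File F139, over F137 `NE7SliceLetterHodgeReduction.sliceLetter_hom_of_hodge` and row NE3's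
`NE3FrameFreeDecompositionW.exists_cornerGauge_mem_frameFreeBlockLandauW` (t4-ne3 formalisation swarm; the slice `NE3FrameFreeSliceW.frameFreeBlockLandauW` = tangent ∧ frame-free ∧
`hsR`-orthogonal to the gauge directions of the corner-trivial nested-block-mean-zero generators `cornerGaugeSpaceW`; on it the swarm PROVED the curved L² slice Poincaré inequality
`NE3SlicePoincareCurved.slicePoincare_frameFreeBlockLandauW` and the L² minimality `NE3FrameFreeSliceW.sum_nhsNormSq_add_gaugeDir_eq_of_mem` — the L² shadow of (c₂)^∞ with `C_H = 2`),
`NE3TangentCovariantTower.tangentIter_iff_dirIter_eq_zero`, `NE3FramePotBoundW.tower_eq_pow_mul`.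
WHY.  F137 displayed (c₂) as «∃ ξ corner-vanishing with `X − gaugeDir W ξ ∈ S_L` and a sup bound».  For `S_L := T_♮(W)` the EXISTENCE is the owner swarm's (E_W); only the SUP
BOUND is a letter.  So after this file the curved (APE)'s slice-solver input is, precisely and finally: two sup-norm statements about objects the tree already defines and controls in
L² — the ℓ^∞ upgrade of row NE3's slice theory (Bałaban's background-field propagator in sup norm, [Balaban1985PropagatorsII]∕B9 TYPE).  `L^d ≥ 2` is (E_W)'s hypothesis.
WHAT ([folklore]; 0 def, 0 sorry).  **`sliceLetter_hom_of_frameFree`** — class data + `L^d ≥ 2` + tension letter `τ_W ≥ 0` + (c₁)^∞ on `frameFreeBlockLandauW L N (j+1) W` + (c₂)^∞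
⟹ (L2)ʰ on every W-tangent skew `(N·L^{j+1})`-periodic `X` with `(K_G, (1 + C_H)K_X + 2d(M−1)C_H(x + K_G·τ_W))`.
HONEST FRAMING (page 1): composition BY NAME; (c₁)^∞, (c₂)^∞ and the tension letter are HYPOTHESES (not proved, not claimed); nothing of Bałaban's asserted; (APE) on curved data NOT
proved; NOT ONE-STEP, NOT NE7; spine 0∕9; finite T⁴ rung (B)+1 — NOT infinite volume, NOT mass gap, NOT `BetaPertH`, NOT Clay.  Continuum YM on T⁴ ⇐ BetaPertH ∧ nine spine estimates
(0/9 proved); BetaPertH ⇐ (D1) ∧ (D4) ∧ CAP+tail; G-an2-4 gates asym, D1 and NE2/3/4.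
-/

set_option autoImplicit false

open scoped BigOperators Matrix.Norms.L2Operator
open NormedSpace Finset

namespace Summit.QuantumFields.BalabanUV.T4Continuum.NE7SliceLetterFrameFreeReduction

open Literature.MathematicalPhysics.QuantumFieldTheory.Balaban1983to89
open B7Prop1Explicit B7Prop2Explicit UnitaryModel
open T4AveragingDeficitWall (Ad IsUnitaryCfg IsSkewDir SmallField curlAt dirL1)
open T4AveragingDeficitWallBoundary (IsPeriodicCfg periodBox)
open AveragingDeficitPeriodicCounting (IsPeriodicDir)
open AveragingDeficitMultiLevelPrep (LevelSmall tower)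
open MinimalActionLevels (perWin)
open BlockAveragePushDirGauge (gaugeDir)
open NE3HessForm (hess dAction)
open NE3TangentCovariantTower (dirIter tangentIter_iff_dirIter_eq_zero)
open NE3FramePotBoundW (tower_eq_pow_mul)
open NE3FrameFreeSliceW (frameFreeBlockLandauW)
open NE3FrameFreeDecompositionW (exists_cornerGauge_mem_frameFreeBlockLandauW)
open NE7SliceLetterHodgeReduction (sliceLetter_hom_of_hodge)

noncomputable section

variable {d : ℕ} {n : Type*} [Fintype n] [DecidableEq n]

/-- **(L2)ʰ ON THE WHOLE TANGENT SLICE FROM TWO SUP-NORM LETTERS ABOUT ROW NE3's FRAME-FREE SLICE.**  Data: `L ≥ 1` with `L^d ≥ 2`, `N ≥ 1`, `j`, `P = N·L^{j+1} ≥ 2`; `W` unitary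
`P`-periodic of the multi-level class; the integrated tension letter `|dAction W K (perWin d P)| ≤ τ_W‖K‖₁` (`τ_W ≥ 0`); (c₁)^∞ the homogeneous two-term letter on
`T_♮(W) = frameFreeBlockLandauW L N (j+1) W` with `(K_G, K_X)`; (c₂)^∞ for every W-tangent skew periodic `X` and every skew periodic corner-vanishing `ξ` with `X − gaugeDir W ξ ∈ T_♮(W)`:
`‖gaugeDir W ξ‖_∞ ≤ C_H·R` whenever `‖X‖_∞ ≤ R`.  THEN (L2)ʰ holds for every W-tangent skew periodic `X` with constants `(K_G, (1 + C_H)K_X + 2d(M−1)C_H(x + K_G·τ_W))`. [folklore] -/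
theorem sliceLetter_hom_of_frameFree [Nonempty n] {L N : ℕ} [NeZero N] (hL : 1 ≤ L) (hLd : 2 ≤ L ^ d) (j : ℕ) (hP : 2 ≤ N * L ^ (j + 1))
    {W : Site d → Fin d → (Matrix n n ℂ)ˣ} {x : ℝ} (hWu : IsUnitaryCfg W) (hWP : IsPeriodicCfg W ((N * L ^ (j + 1) : ℕ) : ℤ))
    (hx : 0 ≤ x) (hs : LevelSmall d L j x) (hWx : SmallField W x)
    {τW : ℝ} (hτ : 0 ≤ τW)
    (hten : ∀ K : Site d → Fin d → Matrix n n ℂ, IsSkewDir K → IsPeriodicDir K ((N * L ^ (j + 1) : ℕ) : ℤ) →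
      |dAction W K (perWin d (N * L ^ (j + 1)))| ≤ τW * dirL1 K (periodBox (d := d) (N * L ^ (j + 1))))
    {KG KX CH : ℝ}
    (hGL : ∀ X ∈ frameFreeBlockLandauW (d := d) (n := n) L N (j + 1) W, IsPeriodicDir X ((N * L ^ (j + 1) : ℕ) : ℤ) → dirIter L (j + 1) W X = 0 →
      ∀ R : ℝ, (∀ y κ', ‖X y κ'‖ ≤ R) → ∀ g : ℝ, 0 ≤ g →
      (∀ Y : Site d → Fin d → Matrix n n ℂ, IsSkewDir Y → IsPeriodicDir Y ((N * L ^ (j + 1) : ℕ) : ℤ) → dirIter L (j + 1) W Y = 0 →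
        |hess W X Y (perWin d (N * L ^ (j + 1)))| ≤ g * dirL1 Y (periodBox (d := d) (N * L ^ (j + 1)))) →
      ∀ z μ' ν', μ' ≠ ν' → ‖curlAt W X z μ' ν'‖ ≤ KG * g + KX * R)
    (hCH : ∀ X : Site d → Fin d → Matrix n n ℂ, IsSkewDir X → IsPeriodicDir X ((N * L ^ (j + 1) : ℕ) : ℤ) → dirIter L (j + 1) W X = 0 →
      ∀ ξ : Site d → Matrix n n ℂ, (∀ y, ξ y ∈ skewAdjoint (Matrix n n ℂ)) → (∀ (y : Site d) (i : Fin d), ξ (y + ((N * L ^ (j + 1) : ℕ) : ℤ) • e i) = ξ y) →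
      (∀ w : Site d, ξ (((L : ℤ) ^ (j + 1)) • w) = 0) → (fun y κ => X y κ - gaugeDir W ξ y κ) ∈ frameFreeBlockLandauW (d := d) (n := n) L N (j + 1) W →
      ∀ R : ℝ, (∀ y κ', ‖X y κ'‖ ≤ R) → ∀ (y : Site d) (κ : Fin d), ‖gaugeDir W ξ y κ‖ ≤ CH * R) :
    ∀ X : Site d → Fin d → Matrix n n ℂ, IsSkewDir X → IsPeriodicDir X ((N * L ^ (j + 1) : ℕ) : ℤ) → dirIter L (j + 1) W X = 0 →
      ∀ R : ℝ, (∀ y κ', ‖X y κ'‖ ≤ R) → ∀ g : ℝ, 0 ≤ g →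
      (∀ Y : Site d → Fin d → Matrix n n ℂ, IsSkewDir Y → IsPeriodicDir Y ((N * L ^ (j + 1) : ℕ) : ℤ) → dirIter L (j + 1) W Y = 0 →
        |hess W X Y (perWin d (N * L ^ (j + 1)))| ≤ g * dirL1 Y (periodBox (d := d) (N * L ^ (j + 1)))) →
      ∀ z μ' ν', μ' ≠ ν' → ‖curlAt W X z μ' ν'‖
        ≤ KG * g + ((1 + CH) * KX + 2 * (d : ℝ) * (((L : ℝ) ^ (j + 1)) - 1) * CH * (x + KG * τW)) * R := by
  -- the period in the tower spelling
  have hT : tower L N (j + 1) = N * L ^ (j + 1) := by rw [tower_eq_pow_mul, Nat.mul_comm]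
  have hWPt : IsPeriodicCfg W ((tower L N (j + 1) : ℕ) : ℤ) := by rw [hT]; exact hWP
  -- F137 with (c₂) := (E_W) + (c₂)^∞
  refine sliceLetter_hom_of_hodge hL j hP hWu hWP hx hs hWx hτ hten (frameFreeBlockLandauW (d := d) (n := n) L N (j + 1) W) hGL ?_
  intro X hXs hXP hXT
  have hXPt : IsPeriodicDir X ((tower L N (j + 1) : ℕ) : ℤ) := by rw [hT]; exact hXP
  have hXTan : AveragingDeficitMultiLevelPrep.TangentIter L j W X := (tangentIter_iff_dirIter_eq_zero L j W X).2 hXT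
  obtain ⟨mu, hmus, hmuP, hmuc, hmem⟩ := exists_cornerGauge_mem_frameFreeBlockLandauW (M := N) hL hLd j hWu hWPt hx hs hWx hXs hXPt hXTan
  have hmuP' : ∀ (y : Site d) (i : Fin d), mu (y + ((N * L ^ (j + 1) : ℕ) : ℤ) • e i) = mu y := by rw [← hT]; exact hmuP
  -- `ξ := −mu`
  have hξs : ∀ y, (fun y => -mu y) y ∈ skewAdjoint (Matrix n n ℂ) := fun y => (skewAdjoint _).neg_mem (hmus y)
  have hξP : ∀ (y : Site d) (i : Fin d), (fun y => -mu y) (y + ((N * L ^ (j + 1) : ℕ) : ℤ) • e i) = (fun y => -mu y) y := fun y i => by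
    simp only [hmuP' y i]
  have hξc : ∀ w : Site d, (fun y => -mu y) (((L : ℤ) ^ (j + 1)) • w) = 0 := fun w => by simp only [hmuc w, neg_zero]
  have hgd : ∀ y κ, gaugeDir W (fun y => -mu y) y κ = -gaugeDir W mu y κ := fun y κ => by
    simp only [gaugeDir, Ad, Matrix.mul_neg, Matrix.neg_mul]; abel
  have hmem' : (fun y κ => X y κ - gaugeDir W (fun y => -mu y) y κ) ∈ frameFreeBlockLandauW (d := d) (n := n) L N (j + 1) W := by
    have heq : (fun y κ => X y κ - gaugeDir W (fun y => -mu y) y κ) = fun y ν => X y ν + gaugeDir W mu y ν := by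
      funext y κ; rw [hgd, sub_neg_eq_add]
    rw [heq]; exact hmem
  exact ⟨fun y => -mu y, hξs, hξP, hξc, hmem', fun R hR => hCH X hXs hXP hXT _ hξs hξP hξc hmem' R hR⟩

end

end Summit.QuantumFields.BalabanUV.T4Continuum.NE7SliceLetterFrameFreeReduction
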